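import Mathlib
import Summits.NavierStokesRegularity.NavierStokesRegularity.Theorems.WakeRatchetTailRatchetScalarFrontEdge
import HarnessLib

/-!
# Scalar dyadic fronts (construction `DyadicScalarFronts`, stmt-NavierStokesRegularity-21808):
# two exact MEAN-LEVEL LAWS — the virial identity `A = ∫ a·(Λg − Λ⁻¹g(s·))` and the cubic identity
# `∫|t|a² = (Λ − Λ⁻¹)·∫ |t|a(t)²·g(st) dt` (the energy-weighted mean of the amplitude one rung out is `F⋆`)

Support file for the crux `WakeRatchet.TailRatchet` (stmt-21808; refuted BY NAME modulo the construction
`WakeRatchetDyadicFront.DyadicScalarFronts`, p589335; MODEL lattice ODEs of Tao 2016 §1.2, §4 — nothing here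
concerns the Navier–Stokes equations, and no item is closed).  Exact identities for the remaining a-priori size
question of programme R-glob (census memo `G2G3-APRIORI-21808-leafhand4-g6.md`): where can the bulk of an
admissible front sit?

With `g(t) = |t|·a(t)` (which tends to `0` at both ends: `…ScalarFrontEdge.amp_tendsto_zero` and boundedness
near `0⁻`), integrating `(d/dt)g = −a + |t|a'` and `(d/dt)g² = 2g·g'` over `(−∞,0)` along the front equation
gives:
* `virial_identity` — `∫_{t<0} a = Λ·∫_{t<0} |t|a(t)² dt − (s/Λ)·∫_{t<0} |t|a(t)a(st) dt`, i.e. the `a dt`-mean of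
  `Λg(t) − Λ⁻¹g(st)` is exactly `1`;
* `cubic_identity` — `∫_{t<0} |t|a(t)² dt = (Λ − Λ⁻¹)·∫_{t<0} |t|a(t)²·g(st) dt`, i.e. the `|t|a² dt`-mean of the
  amplitude ONE RUNG OUT, `g(st)`, is exactly the logistic equilibrium `F⋆ = 1/(Λ − Λ⁻¹)` (`mean_level_eq`):
  a long bulk can only sit at level `F⋆` — the delocalised separable solution `a = F⋆/|t|` — and the amplitude
  floor `sup g ≥ F⋆` (tree: `WakeRatchetScalarFrontFloor`) drops out again (`floor_of_cubic`).

HONEST FRAMING: elementary real analysis about a MODEL lattice ODE; existence of fronts is NOT proved; nothing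
about Navier–Stokes.
-/

noncomputable section

set_option linter.dupNamespace false

namespace Summit.NavierStokesRegularity.NavierStokesRegularity.Theorems

namespace WakeRatchetScalarFrontMeanLevel

open Filter Topology Set MeasureTheory intervalIntegral
open Literature.Analysis.FluidPDE Literature.Analysis.FluidPDE.TaoCascade
open WakeRatchetScalarFrontWake WakeRatchetScalarFrontPositiveWake WakeRatchetScalarFrontAdmissible
open WakeRatchetScalarFrontPositive WakeRatchetScalarFrontAmplitude WakeRatchetScalarFrontEdge

variable {ε₀ s : ℝ} {a : ℝ → ℝ}

/-! ## Integrability of the weighted densities -/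

/-- `|t|·a(t)² = g(t)·a(t)` is integrable on `(−∞,0)` under a type-I bound `g ≤ m` (`a ≥ 0`). [elementary] -/
theorem integrableOn_amp_mul (hcont : ContinuousOn a (Iio 0)) (hint : IntegrableOn a (Iio 0))
    (hnn : ∀ t : ℝ, t < 0 → 0 ≤ a t) {m : ℝ} (hM : ∀ t : ℝ, t < 0 → |t| * |a t| ≤ m) :
    IntegrableOn (fun t => (-t) * a t ^ 2) (Iio 0) := by
  have hc : ContinuousOn (fun t => (-t) * a t ^ 2) (Iio 0) :=
    (continuous_neg.continuousOn).mul (hcont.pow 2)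
  refine Integrable.mono' (g := fun t => m * |a t|) ((hint.abs).const_mul m)
    (hc.aestronglyMeasurable measurableSet_Iio) ?_
  refine (ae_restrict_iff' measurableSet_Iio).2 (Eventually.of_forall fun t ht => ?_)
  have h := hM t ht
  rw [abs_of_neg ht, abs_of_nonneg (hnn t ht)] at h
  have ht0 : t < 0 := ht
  rw [Real.norm_eq_abs, abs_of_nonneg (mul_nonneg (by linarith) (sq_nonneg _)),
    abs_of_nonneg (hnn t ht), sq, ← mul_assoc]
  exact mul_le_mul_of_nonneg_right h (hnn t ht)

/-- `|t|·a(t)·a(st) = g(t)·a(st)` is integrable on `(−∞,0)` under a type-I bound. [elementary] -/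
theorem integrableOn_amp_mul_shift (hs : 0 < s) (hcont : ContinuousOn a (Iio 0)) (hint : IntegrableOn a (Iio 0))
    (hnn : ∀ t : ℝ, t < 0 → 0 ≤ a t) {m : ℝ} (hM : ∀ t : ℝ, t < 0 → |t| * |a t| ≤ m) :
    IntegrableOn (fun t => (-t) * a t * a (s * t)) (Iio 0) := by
  have hc2 : ContinuousOn (fun t => a (s * t)) (Iio 0) :=
    hcont.comp (continuous_const.mul continuous_id).continuousOn (fun t ht => mul_neg_of_pos_of_neg hs ht)
  have hc : ContinuousOn (fun t => (-t) * a t * a (s * t)) (Iio 0) :=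
    ((continuous_neg.continuousOn).mul hcont).mul hc2
  have hI : IntegrableOn (fun t => a (s * t)) (Iio 0) := integrableOn_comp_mul hs hint
  refine Integrable.mono' (g := fun t => m * |a (s * t)|) ((hI.abs).const_mul m)
    (hc.aestronglyMeasurable measurableSet_Iio) ?_
  refine (ae_restrict_iff' measurableSet_Iio).2 (Eventually.of_forall fun t ht => ?_)
  have h := hM t ht
  have hst : s * t < 0 := mul_neg_of_pos_of_neg hs ht
  rw [abs_of_neg ht, abs_of_nonneg (hnn t ht)] at h
  have ht0 : t < 0 := ht
  rw [Real.norm_eq_abs, abs_of_nonneg (mul_nonneg (mul_nonneg (by linarith) (hnn t ht)) (hnn _ hst)),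
    abs_of_nonneg (hnn _ hst)]
  exact mul_le_mul_of_nonneg_right h (hnn _ hst)

/-- `|t|·a(t/s)² = s·g(t/s)·a(t/s)` is integrable on `(−∞,0)` under a type-I bound. [elementary] -/
theorem integrableOn_amp_feed (hs : 0 < s) (hcont : ContinuousOn a (Iio 0)) (hint : IntegrableOn a (Iio 0))
    (hnn : ∀ t : ℝ, t < 0 → 0 ≤ a t) {m : ℝ} (hM : ∀ t : ℝ, t < 0 → |t| * |a t| ≤ m) :
    IntegrableOn (fun t => (-t) * a (t / s) ^ 2) (Iio 0) := by
  have hcd : ContinuousOn (fun t => a (t / s)) (Iio 0) :=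
    hcont.comp (continuous_id.div_const s).continuousOn (fun t ht => div_neg_of_neg_of_pos ht hs)
  have hc : ContinuousOn (fun t => (-t) * a (t / s) ^ 2) (Iio 0) :=
    (continuous_neg.continuousOn).mul (hcd.pow 2)
  have hId : IntegrableOn (fun t => a (t / s)) (Iio 0) := integrableOn_comp_div hs hint
  refine Integrable.mono' (g := fun t => s * m * |a (t / s)|) ((hId.abs).const_mul (s * m))
    (hc.aestronglyMeasurable measurableSet_Iio) ?_
  refine (ae_restrict_iff' measurableSet_Iio).2 (Eventually.of_forall fun t ht => ?_)
  have ht0 : t < 0 := ht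
  have hts : t / s < 0 := div_neg_of_neg_of_pos ht0 hs
  have h := hM (t / s) hts
  rw [abs_of_neg hts, abs_of_nonneg (hnn _ hts)] at h
  rw [Real.norm_eq_abs, abs_of_nonneg (mul_nonneg (by linarith) (sq_nonneg _)), abs_of_nonneg (hnn _ hts)]
  have e : (-t) * a (t / s) ^ 2 = s * ((-(t / s)) * a (t / s)) * a (t / s) := by
    field_simp
  rw [e]
  exact mul_le_mul_of_nonneg_right (mul_le_mul_of_nonneg_left h hs.le) (hnn _ hts)

/-- The renormalised amplitude `g(t) = −t·a(t)` of a profile of `DyadicScalarFronts` tends to `0` at `0⁻`.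
[elementary] -/
theorem amp_tendsto_zero_left
    (hbdd : ∃ t₀ : ℝ, t₀ < 0 ∧ ∃ P : ℝ, ∀ t : ℝ, t₀ ≤ t → t < 0 → |a t| ≤ P) :
    Tendsto (fun t : ℝ => -t * a t) (𝓝[<] 0) (𝓝 0) := by
  obtain ⟨t₀, ht₀, P₀, hP₀⟩ := hbdd
  have h1 : Tendsto (fun t : ℝ => P₀ * -t) (𝓝[<] 0) (𝓝 (P₀ * -0)) :=
    ((continuous_const.mul continuous_neg).tendsto 0).mono_left nhdsWithin_le_nhds
  rw [neg_zero, mul_zero] at h1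
  refine squeeze_zero_norm' ?_ h1
  filter_upwards [Ico_mem_nhdsLT ht₀] with t ht
  rw [Real.norm_eq_abs, abs_mul, abs_neg, abs_of_neg ht.2, mul_comm]
  exact mul_le_mul_of_nonneg_right (hP₀ t ht.1 ht.2) (by linarith [ht.2])

/-! ## The virial identity -/

/-- **Virial identity.**  For every profile of `DyadicScalarFronts`:
`∫_{t<0} a = Λ·∫_{t<0} |t|·a(t)² dt − (s/Λ)·∫_{t<0} |t|·a(t)·a(st) dt`.
[cite: Tao2016AveragedNS, §1.2 (dyadic model), §4 Lemma 4.1 (4.8); elementary] -/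
theorem virial_identity (hε : 0 < ε₀) (hs : 1 < s)
    (hode : ∀ t : ℝ, t < 0 → HasDerivAt a
      (bigLam ε₀ / s ^ 2 * a (t / s) ^ 2 - s / bigLam ε₀ * a t * a (s * t)) t)
    (hint : IntegrableOn a (Iio 0))
    (hbdd : ∃ t₀ : ℝ, t₀ < 0 ∧ ∃ P : ℝ, ∀ t : ℝ, t₀ ≤ t → t < 0 → |a t| ≤ P) :
    ∫ t in Iio 0, a t
      = bigLam ε₀ * (∫ t in Iio 0, (-t) * a t ^ 2) - s / bigLam ε₀ * ∫ t in Iio 0, (-t) * a t * a (s * t) := by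
  have hs0 : 0 < s := by linarith
  have hΛ : 0 < bigLam ε₀ := bigLam_pos (by linarith)
  have hcont := continuousOn_of_ode hode
  have hnn := nonneg_of_front hε hs hode hint hbdd
  obtain ⟨m, hm⟩ := scale_bound hε hs hode hint hbdd
  obtain ⟨P, hP⟩ := bounded hε hs hode hint hbdd
  have hI1 : IntegrableOn (fun t => (-t) * a t ^ 2) (Iio 0) := integrableOn_amp_mul hcont hint hnn hm
  have hI2 : IntegrableOn (fun t => (-t) * a t * a (s * t)) (Iio 0) :=
    integrableOn_amp_mul_shift hs0 hcont hint hnn hm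
  -- the feed density `(-t) a(t/s)²` integrates to `s² ∫ (-u) a(u)²` (substitution `u = t/s`)
  have hI3 : IntegrableOn (fun t => (-t) * a (t / s) ^ 2) (Iio 0) :=
    integrableOn_amp_feed hs0 hcont hint hnn hm
  -- derivative of `g(t) = -t a(t)`: `-a t - t·rhs`
  set f : ℝ → ℝ := fun t => -a t - t * (bigLam ε₀ / s ^ 2 * a (t / s) ^ 2 - s / bigLam ε₀ * a t * a (s * t))
    with hf
  have hfint : IntegrableOn f (Iio 0) := by
    have h0 : IntegrableOn (fun t => -a t + bigLam ε₀ / s ^ 2 * ((-t) * a (t / s) ^ 2)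
        - s / bigLam ε₀ * ((-t) * a t * a (s * t))) (Iio 0) :=
      ((hint.neg).add (hI3.const_mul _)).sub (hI2.const_mul _)
    refine h0.congr_fun (fun t _ => ?_) measurableSet_Iio
    simp only [hf]; ring
  -- FTC on `(A, 0)` with one-sided limit `g(0⁻) = 0`
  have hg0 : Tendsto (fun t : ℝ => -t * a t) (𝓝[<] 0) (𝓝 0) := amp_tendsto_zero_left hbdd
  have hgbot : Tendsto (fun t : ℝ => -t * a t) atBot (𝓝 0) := amp_tendsto_zero hε hs hode hint hbdd
  have hbal : ∀ A : ℝ, A < 0 → ∫ t in A..0, f t = 0 - (-A * a A) := by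
    intro A hA
    exact intervalIntegral.integral_eq_sub_of_hasDerivAt_of_tendsto hA
      (fun t ht => hasDerivAt_amp hode ht.2) (intervalIntegrable_of_Iio hfint hA.le)
      ((hasDerivAt_amp hode hA).continuousAt.continuousWithinAt.tendsto) hg0
  -- let `A → −∞`
  have hfIic : IntegrableOn f (Iic 0) := (integrableOn_Iic_iff_integrableOn_Iio (by finiteness)).2 hfint
  have hlim := intervalIntegral_tendsto_integral_Iic 0 hfIic tendsto_id
  have hlim2 : Tendsto (fun A : ℝ => 0 - (-A * a A)) atBot (𝓝 (0 - 0)) := tendsto_const_nhds.sub hgbot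
  have heq : (fun A : ℝ => ∫ t in A..0, f t) =ᶠ[atBot] (fun A : ℝ => 0 - (-A * a A)) := by
    filter_upwards [eventually_lt_atBot (0 : ℝ)] with A hA using hbal A hA
  have hfin := tendsto_nhds_unique (hlim.congr' heq) hlim2
  rw [sub_zero, integral_Iic_eq_integral_Iio] at hfin
  -- unfold `∫ f = 0` into the identity
  have h1 : Integrable (fun t => -a t) (volume.restrict (Iio 0)) := hint.neg
  have h2 : Integrable (fun t => bigLam ε₀ / s ^ 2 * ((-t) * a (t / s) ^ 2)) (volume.restrict (Iio 0)) :=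
    hI3.const_mul _
  have h3 : Integrable (fun t => s / bigLam ε₀ * ((-t) * a t * a (s * t))) (volume.restrict (Iio 0)) :=
    hI2.const_mul _
  have i12 : Integrable (fun t => -a t + bigLam ε₀ / s ^ 2 * ((-t) * a (t / s) ^ 2))
      (volume.restrict (Iio 0)) := h1.add h2
  have hsplit : ∫ t in Iio 0, f t = -(∫ t in Iio 0, a t) + bigLam ε₀ / s ^ 2 * (∫ t in Iio 0, (-t) * a (t / s) ^ 2)
      - s / bigLam ε₀ * ∫ t in Iio 0, (-t) * a t * a (s * t) := by
    have e : ∀ t, f t = -a t + bigLam ε₀ / s ^ 2 * ((-t) * a (t / s) ^ 2)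
        - s / bigLam ε₀ * ((-t) * a t * a (s * t)) := fun t => by simp only [hf]; ring
    simp_rw [e]
    rw [integral_sub i12 h3, integral_add h1 h2, MeasureTheory.integral_neg, MeasureTheory.integral_const_mul,
      MeasureTheory.integral_const_mul]
  have hsubst : ∫ t in Iio 0, (-t) * a (t / s) ^ 2 = s ^ 2 * ∫ t in Iio 0, (-t) * a t ^ 2 := by
    have h := integral_comp_div_Iio (fun u => (-u) * a u ^ 2) hs0
    have e : (fun t : ℝ => -(t / s) * a (t / s) ^ 2) = fun t => s⁻¹ * ((-t) * a (t / s) ^ 2) := by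
      funext t; field_simp
    rw [e, MeasureTheory.integral_const_mul] at h
    calc ∫ t in Iio 0, (-t) * a (t / s) ^ 2 = s * (s⁻¹ * ∫ t in Iio 0, (-t) * a (t / s) ^ 2) := by
          field_simp
      _ = s * (s * ∫ t in Iio 0, (-t) * a t ^ 2) := by rw [h]
      _ = s ^ 2 * ∫ t in Iio 0, (-t) * a t ^ 2 := by ring
  rw [hsplit, hsubst] at hfin
  have e3 : bigLam ε₀ / s ^ 2 * (s ^ 2 * ∫ t in Iio 0, (-t) * a t ^ 2) = bigLam ε₀ * ∫ t in Iio 0, (-t) * a t ^ 2 := by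
    field_simp
  rw [e3] at hfin
  linarith

/-! ## The cubic identity and the mean-level law -/

/-- **Cubic identity.**  For every profile of `DyadicScalarFronts`:
`∫_{t<0} |t|·a(t)² dt = (Λ − Λ⁻¹)·s·∫_{t<0} t²·a(t)²·a(st) dt`.
[cite: Tao2016AveragedNS, §1.2 (dyadic model), §4 Lemma 4.1 (4.8); elementary] -/
theorem cubic_identity (hε : 0 < ε₀) (hs : 1 < s)
    (hode : ∀ t : ℝ, t < 0 → HasDerivAt a
      (bigLam ε₀ / s ^ 2 * a (t / s) ^ 2 - s / bigLam ε₀ * a t * a (s * t)) t)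
    (hint : IntegrableOn a (Iio 0))
    (hbdd : ∃ t₀ : ℝ, t₀ < 0 ∧ ∃ P : ℝ, ∀ t : ℝ, t₀ ≤ t → t < 0 → |a t| ≤ P) :
    ∫ t in Iio 0, (-t) * a t ^ 2
      = (bigLam ε₀ - (bigLam ε₀)⁻¹) * s * ∫ t in Iio 0, t ^ 2 * a t ^ 2 * a (s * t) := by
  have hs0 : 0 < s := by linarith
  have hΛ : 0 < bigLam ε₀ := bigLam_pos (by linarith)
  have hcont := continuousOn_of_ode hode
  have hnn := nonneg_of_front hε hs hode hint hbdd
  obtain ⟨m, hm⟩ := scale_bound hε hs hode hint hbdd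
  have hm' : ∀ t : ℝ, t < 0 → -t * a t ≤ m := by
    intro t ht; have h := hm t ht; rwa [abs_of_neg ht, abs_of_nonneg (hnn t ht)] at h
  have hm0 : 0 ≤ m := le_trans (by positivity) (hm (-1) (by norm_num))
  have hI1 : IntegrableOn (fun t => (-t) * a t ^ 2) (Iio 0) := integrableOn_amp_mul hcont hint hnn hm
  have hI2 : IntegrableOn (fun t => (-t) * a t * a (s * t)) (Iio 0) :=
    integrableOn_amp_mul_shift hs0 hcont hint hnn hm
  have hI3 : IntegrableOn (fun t => (-t) * a (t / s) ^ 2) (Iio 0) := integrableOn_amp_feed hs0 hcont hint hnn hm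
  -- the cubic densities, dominated by `m ×` the quadratic ones
  have hc2 : ContinuousOn (fun t => a (s * t)) (Iio 0) :=
    hcont.comp (continuous_const.mul continuous_id).continuousOn (fun t ht => mul_neg_of_pos_of_neg hs0 ht)
  have hcd : ContinuousOn (fun t => a (t / s)) (Iio 0) :=
    hcont.comp (continuous_id.div_const s).continuousOn (fun t ht => div_neg_of_neg_of_pos ht hs0)
  have hJ2 : IntegrableOn (fun t => t ^ 2 * a t * a (t / s) ^ 2) (Iio 0) := by
    have hc : ContinuousOn (fun t => t ^ 2 * a t * a (t / s) ^ 2) (Iio 0) :=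
      (((continuous_pow 2).continuousOn).mul hcont).mul (hcd.pow 2)
    refine Integrable.mono' (g := fun t => m * |(-t) * a (t / s) ^ 2|) ((hI3.abs).const_mul m)
      (hc.aestronglyMeasurable measurableSet_Iio) ?_
    refine (ae_restrict_iff' measurableSet_Iio).2 (Eventually.of_forall fun t ht => ?_)
    have ht0 : t < 0 := ht
    have hts : t / s < 0 := div_neg_of_neg_of_pos ht0 hs0
    have hpos : 0 ≤ (-t) * a (t / s) ^ 2 := mul_nonneg (by linarith) (sq_nonneg _)
    rw [Real.norm_eq_abs, abs_of_nonneg (mul_nonneg (mul_nonneg (sq_nonneg _) (hnn t ht0)) (sq_nonneg _)),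
      abs_of_nonneg hpos]
    have e : t ^ 2 * a t * a (t / s) ^ 2 = ((-t) * a t) * ((-t) * a (t / s) ^ 2) := by ring
    rw [e]
    exact mul_le_mul_of_nonneg_right (hm' t ht0) hpos
  have hJ3 : IntegrableOn (fun t => t ^ 2 * a t ^ 2 * a (s * t)) (Iio 0) := by
    have hc : ContinuousOn (fun t => t ^ 2 * a t ^ 2 * a (s * t)) (Iio 0) :=
      (((continuous_pow 2).continuousOn).mul (hcont.pow 2)).mul hc2
    refine Integrable.mono' (g := fun t => m * |(-t) * a t * a (s * t)|) ((hI2.abs).const_mul m)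
      (hc.aestronglyMeasurable measurableSet_Iio) ?_
    refine (ae_restrict_iff' measurableSet_Iio).2 (Eventually.of_forall fun t ht => ?_)
    have ht0 : t < 0 := ht
    have hst : s * t < 0 := mul_neg_of_pos_of_neg hs0 ht0
    have hpos : 0 ≤ (-t) * a t * a (s * t) := mul_nonneg (mul_nonneg (by linarith) (hnn t ht0)) (hnn _ hst)
    rw [Real.norm_eq_abs, abs_of_nonneg (mul_nonneg (mul_nonneg (sq_nonneg _) (sq_nonneg _)) (hnn _ hst)),
      abs_of_nonneg hpos]
    have e : t ^ 2 * a t ^ 2 * a (s * t) = ((-t) * a t) * ((-t) * a t * a (s * t)) := by ring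
    rw [e]
    exact mul_le_mul_of_nonneg_right (hm' t ht0) hpos
  -- the derivative of `g² = (−t a)²` is `k = 2 g g'`
  set k : ℝ → ℝ := fun t => -2 * ((-t) * a t ^ 2) + 2 * (bigLam ε₀ / s ^ 2) * (t ^ 2 * a t * a (t / s) ^ 2)
    - 2 * (s / bigLam ε₀) * (t ^ 2 * a t ^ 2 * a (s * t)) with hk
  have hG : ∀ t : ℝ, t < 0 → HasDerivAt (fun u : ℝ => (-u * a u) ^ 2) (k t) t := by
    intro t ht
    have h := (hasDerivAt_amp hode ht).pow 2
    refine h.congr_deriv ?_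
    simp only [hk]
    ring
  have hkint : IntegrableOn k (Iio 0) := by
    have h0 : IntegrableOn (fun t => -2 * ((-t) * a t ^ 2) + 2 * (bigLam ε₀ / s ^ 2) * (t ^ 2 * a t * a (t / s) ^ 2)
        - 2 * (s / bigLam ε₀) * (t ^ 2 * a t ^ 2 * a (s * t))) (Iio 0) :=
      ((hI1.const_mul _).add (hJ2.const_mul _)).sub (hJ3.const_mul _)
    exact h0
  have hG0 : Tendsto (fun t : ℝ => (-t * a t) ^ 2) (𝓝[<] 0) (𝓝 0) := by
    have := (amp_tendsto_zero_left (a := a) hbdd).pow 2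
    simpa using this
  have hGbot : Tendsto (fun t : ℝ => (-t * a t) ^ 2) atBot (𝓝 0) := by
    have := (amp_tendsto_zero hε hs hode hint hbdd).pow 2
    simpa using this
  have hbal : ∀ A : ℝ, A < 0 → ∫ t in A..0, k t = 0 - (-A * a A) ^ 2 := by
    intro A hA
    exact intervalIntegral.integral_eq_sub_of_hasDerivAt_of_tendsto hA
      (fun t ht => hG t ht.2) (intervalIntegrable_of_Iio hkint hA.le)
      ((hG A hA).continuousAt.continuousWithinAt.tendsto) hG0
  have hkIic : IntegrableOn k (Iic 0) := (integrableOn_Iic_iff_integrableOn_Iio (by finiteness)).2 hkint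
  have hlim := intervalIntegral_tendsto_integral_Iic 0 hkIic tendsto_id
  have hlim2 : Tendsto (fun A : ℝ => 0 - (-A * a A) ^ 2) atBot (𝓝 (0 - 0)) := tendsto_const_nhds.sub hGbot
  have heq : (fun A : ℝ => ∫ t in A..0, k t) =ᶠ[atBot] (fun A : ℝ => 0 - (-A * a A) ^ 2) := by
    filter_upwards [eventually_lt_atBot (0 : ℝ)] with A hA using hbal A hA
  have hfin := tendsto_nhds_unique (hlim.congr' heq) hlim2
  rw [sub_zero, integral_Iic_eq_integral_Iio] at hfin
  -- expand `∫ k = 0`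
  have h1 : Integrable (fun t => -2 * ((-t) * a t ^ 2)) (volume.restrict (Iio 0)) := hI1.const_mul _
  have h2 : Integrable (fun t => 2 * (bigLam ε₀ / s ^ 2) * (t ^ 2 * a t * a (t / s) ^ 2))
      (volume.restrict (Iio 0)) := hJ2.const_mul _
  have h3 : Integrable (fun t => 2 * (s / bigLam ε₀) * (t ^ 2 * a t ^ 2 * a (s * t)))
      (volume.restrict (Iio 0)) := hJ3.const_mul _
  have i12 : Integrable (fun t => -2 * ((-t) * a t ^ 2) + 2 * (bigLam ε₀ / s ^ 2) * (t ^ 2 * a t * a (t / s) ^ 2))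
      (volume.restrict (Iio 0)) := h1.add h2
  have hsplit : ∫ t in Iio 0, k t = -2 * (∫ t in Iio 0, (-t) * a t ^ 2)
      + 2 * (bigLam ε₀ / s ^ 2) * (∫ t in Iio 0, t ^ 2 * a t * a (t / s) ^ 2)
      - 2 * (s / bigLam ε₀) * ∫ t in Iio 0, t ^ 2 * a t ^ 2 * a (s * t) := by
    simp only [hk]
    rw [integral_sub i12 h3, integral_add h1 h2, MeasureTheory.integral_const_mul,
      MeasureTheory.integral_const_mul, MeasureTheory.integral_const_mul]
  -- substitution `u = t/s` in the middle integral: `∫ t² a(t) a(t/s)² = s³ ∫ u² a(u)² a(su)`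
  have hsubst : ∫ t in Iio 0, t ^ 2 * a t * a (t / s) ^ 2 = s ^ 3 * ∫ t in Iio 0, t ^ 2 * a t ^ 2 * a (s * t) := by
    have h := integral_comp_div_Iio (fun u => u ^ 2 * a u ^ 2 * a (s * u)) hs0
    have e : (fun t : ℝ => (t / s) ^ 2 * a (t / s) ^ 2 * a (s * (t / s)))
        = fun t => (s ^ 2)⁻¹ * (t ^ 2 * a t * a (t / s) ^ 2) := by
      funext t
      rw [mul_div_cancel₀ t hs0.ne']
      field_simp
    rw [e, MeasureTheory.integral_const_mul] at h
    have hs2 : (s ^ 2)⁻¹ ≠ 0 := inv_ne_zero (pow_ne_zero 2 hs0.ne')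
    calc ∫ t in Iio 0, t ^ 2 * a t * a (t / s) ^ 2
        = s ^ 2 * ((s ^ 2)⁻¹ * ∫ t in Iio 0, t ^ 2 * a t * a (t / s) ^ 2) := by field_simp
      _ = s ^ 2 * (s * ∫ t in Iio 0, t ^ 2 * a t ^ 2 * a (s * t)) := by rw [h]
      _ = s ^ 3 * ∫ t in Iio 0, t ^ 2 * a t ^ 2 * a (s * t) := by ring
  rw [hsplit, hsubst] at hfin
  have hsne : s ≠ 0 := hs0.ne'
  have hΛne : bigLam ε₀ ≠ 0 := hΛ.ne'
  field_simp at hfin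
  field_simp
  linarith [hfin]

/-- **Mean-level law.**  For every profile of `DyadicScalarFronts`:
`∫_{t<0} |t|a(t)² dt = (Λ − Λ⁻¹)·∫_{t<0} |t|a(t)²·(|st|·a(st)) dt` — against the measure `|t|a(t)² dt` the
renormalised amplitude one rung out, `g(st)`, has mean exactly `F⋆ = 1/(Λ − Λ⁻¹)`.
[cite: Tao2016AveragedNS, §1.2, §4; elementary] -/
theorem mean_level_eq (hε : 0 < ε₀) (hs : 1 < s)
    (hode : ∀ t : ℝ, t < 0 → HasDerivAt a
      (bigLam ε₀ / s ^ 2 * a (t / s) ^ 2 - s / bigLam ε₀ * a t * a (s * t)) t)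
    (hint : IntegrableOn a (Iio 0))
    (hbdd : ∃ t₀ : ℝ, t₀ < 0 ∧ ∃ P : ℝ, ∀ t : ℝ, t₀ ≤ t → t < 0 → |a t| ≤ P) :
    ∫ t in Iio 0, (-t) * a t ^ 2
      = (bigLam ε₀ - (bigLam ε₀)⁻¹) * ∫ t in Iio 0, (-t) * a t ^ 2 * (-(s * t) * a (s * t)) := by
  have h := cubic_identity hε hs hode hint hbdd
  have e : (fun t : ℝ => (-t) * a t ^ 2 * (-(s * t) * a (s * t))) = fun t => s * (t ^ 2 * a t ^ 2 * a (s * t)) := by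
    funext t; ring
  rw [e, MeasureTheory.integral_const_mul, ← mul_assoc]
  exact h

end WakeRatchetScalarFrontMeanLevel

end Summit.NavierStokesRegularity.NavierStokesRegularity.Theorems

end
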